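import Mathlib
import HarnessLib
import Literature.NumberTheory.Automorphic.IsobaricRigidityRepData
import Literature.NumberTheory.Automorphic.GaloisActionPlaces
import Literature.NumberTheory.Automorphic.KimExteriorSquareGL4Lemmas
import Literature.NumberTheory.Automorphic.KimExteriorSquareGL4Proofs
import Literature.NumberTheory.Automorphic.TunnellOctahedralGlobalProofs
import Literature.NumberTheory.Automorphic.ArthurClozelCuspidalDescentGLOneHolds
import Literature.NumberTheory.Automorphic.AutomorphicTwistHecke
import Literature.NumberTheory.Automorphic.HeckeCharacterPairRigidity
import Literature.NumberTheory.Automorphic.RamakrishnanMultiplicityOneDihedral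
import Literature.NumberTheory.GaloisRepresentations.HeckeCharacter
import Literature.NumberTheory.Automorphic.AsaiAtOneRankOne
import Literature.NumberTheory.Automorphic.CuspidalDescentDetCubicRepData
import Literature.NumberTheory.Automorphic.PairLFunctionBaseChange

/-!
# Central character descent in Case I (stub `stub_centralCharacterDescent`)

Crux `stmt-Langlands-18053` (`Summit.Langlands.Langlands.Theses.ExteriorSquareAscent.InducedSquareAscent`),
line `Sketch-klein-cube-pole-transfer`, service stub `stub_centralCharacterDescent` of the Klein-cube
skeleton, proved here over tree theorems only.

Setting: `L/K` a Galois quadratic extension of number fields with non-trivial automorphism `τ`,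
`π₀` cuspidal on `GL₄(𝔸_K)`, `P₀` cuspidal on `GL₃(𝔸_L)`, both with zero-free Satake parameters at
almost all places, matched as in the crux (at a.e. `v`: `∧² t_{π₀,v} = t_{P₀,w₁} ⊔ t_{P₀,w₂}` at a
split `v = w₁ w₂`, `= γ ⊔ (-γ)` with `γ² = t_{P₀,w}` at a non-split `v`), and satisfying "Case I":
`t_{P₀,w}⁻¹ = ω(ϖ_v)^{-f(w|v)} t_{P₀,w}` a.e. (`ω(ϖ_v) = e₄(t_{π₀,v})`). Conclusion: the central
character of `P₀` descends — there is a Hecke character `μ` of `K` with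
`e₃(t_{P₀,w}) = μ(ϖ_v)^{f(w|v)}` for almost all `w`.

Proof (all ingredients are theorems of the tree): the unramified central character `Ω` of `P₀`
(`exists_heckeCharacter_prod_satake'`) satisfies `Ω(ϖ_{τ w}) = Ω(ϖ_w)` for a.e. `w` — at a
`τ`-moved `w` the fibre of `v = w ∩ 𝓞 K` is `{w, τ w}` with `f = 1`
(`HeightOneSpectrum.eq_or_eq_smul_of_under_eq`, `HeightOneSpectrum.inertiaDeg_eq_one_of_smul_ne`),
the matching gives `e₃(β₁) e₃(β₂) = ω³` (`prod_wedgeTwoParams_of_card_eq_four`) and Case I gives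
`e₃(βᵢ)² = ω³`, so `e₃(β₁) = e₃(β₂)`. Hence `Ω ∘ τ = Ω` (Hecke rigidity
`HeckeCharacter.ext_of_eventually_valueAtUniformizer_eq` with
`HeckeCharacter.valueAtUniformizer_galConj`), `Ω` is `Gal(L/K) = {1, τ}`-invariant
(`AlgEquiv.eq_one_or_eq_of_finrank_eq_two`), so `Ω = μ ∘ N_{L/K}` by the proved `GL(1)` descent
`HeckeCharacter.exists_baseChange_eq_of_forall_smul_eq` (Arthur–Clozel, Ch. 3, Thm. 4.2 (d), rank
one), and `(μ ∘ N_{L/K})(ϖ_w) = μ(ϖ_v)^{f(w|v)}` a.e.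
(`HeckeCharacter.eventually_valueAtUniformizer_baseChange`).

Not here: the other stubs of the skeleton (Galois-conjugate datum, unitary reduction, local
identities, duality dichotomy, Klein-cube pole, Jacquet–Shalika leaves).
-/

-- binder names of the registered stub signature are fixed by the skeleton (some are unused)
set_option linter.unusedVariables false
-- the summit namespace `Summit.Langlands.Langlands.…` repeats `Langlands` by design
set_option linter.dupNamespace false

noncomputable section

namespace Summit.Langlands.Langlands.Theorems.InducedSquareAscentKleinCube

open scoped Classical NumberField
open Filter IsDedekindDomain NumberField
open Literature.NumberTheory.Automorphic
open Literature.NumberTheory.GaloisRepresentations (HeckeCharacter)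

/-- **From "almost all `w`" to "almost all `w`, all places in the fibre of `w`"**: a property of
all but finitely many finite places of `L` holds, for all but finitely many `w`, at every place
`u` of `L` above the place `w ∩ 𝓞 K` of `K` below `w` (finite fibres of `w ↦ w ∩ 𝓞 K`,
`tendsto_under_cofinite`, and `eventually_forall_under_eq`). [folklore] -/
theorem ccd_eventually_forall_under_eq_under (K : Type) {L : Type} [Field K] [NumberField K]
    [Field L] [NumberField L] [Algebra K L] {p : HeightOneSpectrum (𝓞 L) → Prop}
    (h : ∀ᶠ w in cofinite, p w) :
    ∀ᶠ w : HeightOneSpectrum (𝓞 L) in cofinite,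
      ∀ u : HeightOneSpectrum (𝓞 L), u.under (𝓞 K) = w.under (𝓞 K) → p u :=
  ((tendsto_under_cofinite (𝓞 K)).eventually (eventually_forall_under_eq (F := K) h)).mono
    fun _ hw u hu => hw u (congrArg HeightOneSpectrum.asIdeal hu)

/-- **"Case I" at a place of residue degree one, on determinants**: if `β⁻¹ = (ω¹)⁻¹ • β`
entrywise for a multiset `β` of three non-zero complex numbers and `ω ≠ 0`, then
`(∏ β)² = ω³` (take `Multiset.prod` of both sides). [folklore] -/
theorem ccd_prod_sq_eq_of_map_inv_eq {β : Multiset ℂ} {ω : ℂ} (hβ3 : Multiset.card β = 3)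
    (hω : ω ≠ 0) (hb : β.prod ≠ 0)
    (h : β.map (fun b => b⁻¹) = β.map (fun b => (ω ^ 1)⁻¹ * b)) :
    β.prod ^ 2 = ω ^ 3 := by
  have e1 : (β.map (fun b => b⁻¹)).prod = β.prod⁻¹ := Multiset.prod_map_inv' β
  have e2 : (β.map (fun b => (ω ^ 1)⁻¹ * b)).prod = ω⁻¹ ^ 3 * β.prod := by
    rw [Multiset.prod_map_mul, Multiset.map_const', Multiset.prod_replicate, Multiset.map_id',
      hβ3, pow_one]
  have h1 : β.prod⁻¹ = ω⁻¹ ^ 3 * β.prod := by rw [← e1, ← e2, h]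
  calc β.prod ^ 2 = (ω * ω⁻¹) ^ 3 * β.prod * β.prod := by
        rw [mul_inv_cancel₀ hω, one_pow, one_mul, sq]
    _ = ω ^ 3 * β.prod * (ω⁻¹ ^ 3 * β.prod) := by ring
    _ = ω ^ 3 * β.prod * β.prod⁻¹ := by rw [← h1]
    _ = ω ^ 3 := by rw [mul_assoc, mul_inv_cancel₀ hb, mul_one]

/-- **Central character descent (Case I).** For `L/K` Galois quadratic with non-trivial
automorphism `τ`, `π₀` cuspidal on `GL₄(𝔸_K)` and `P₀` cuspidal on `GL₃(𝔸_L)` with zero-free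
Satake parameters a.e., matched as in the crux (`∧² t_{π₀,v}` is the automorphic-induction
multiset of `P₀` at a.e. `v`), and satisfying Case I (`t_{P₀,w}⁻¹ = ω(ϖ_v)^{-f(w|v)} t_{P₀,w}`
a.e., `ω = ω_{π₀}`), the central character of `P₀` is a base change from `K`: there is a Hecke
character `μ` of `K` with `e₃(t_{P₀,w}) = μ(ϖ_v)^{f(w|v)}` for almost all `w`. Proof: the
unramified central character `Ω` of `P₀` (`exists_heckeCharacter_prod_satake'`) satisfies
`Ω(ϖ_{τ w}) = Ω(ϖ_w)` a.e. — trivial at `τ`-fixed `w`; at a moved `w` (`f = 1`,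
`HeightOneSpectrum.inertiaDeg_eq_one_of_smul_ne`) the matching gives `e₃(β₁) e₃(β₂) = ω³`
(`prod_wedgeTwoParams_of_card_eq_four`) for the Satake parameters `β₁, β₂` of `P₀` at the two
places `{w, τ w}` above `v` (`HeightOneSpectrum.eq_or_eq_smul_of_under_eq`), while Case I gives
`e₃(βᵢ)² = ω³`, whence `e₃(β₁) = e₃(β₂)`. So `Ω ∘ τ = Ω` by Hecke rigidity
(`HeckeCharacter.ext_of_eventually_valueAtUniformizer_eq`, `HeckeCharacter.valueAtUniformizer_galConj`),
`Ω` is `Gal(L/K)`-invariant (`Gal = {1, τ}`, `AlgEquiv.eq_one_or_eq_of_finrank_eq_two`), hence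
`Ω = μ ∘ N_{L/K}` by `GL(1)` descent (`HeckeCharacter.exists_baseChange_eq_of_forall_smul_eq`,
Arthur–Clozel Ch. 3, Thm. 4.2 (d) in rank one), and `(μ ∘ N)(ϖ_w) = μ(ϖ_v)^{f(w|v)}` a.e.
(`HeckeCharacter.eventually_valueAtUniformizer_baseChange`).
[cite: ArthurClozelAMS120, Ch. 3, Thm. 4.2 (d)] -/
theorem stub_centralCharacterDescent :
    ∀ (K L : Type) [Field K] [NumberField K] [Field L] [NumberField L] [Algebra K L] [IsGalois K L],
      Module.finrank K L = 2 → ∀ (τ : L ≃ₐ[K] L), τ ≠ 1 →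
      ∀ (hcpt : isCompact_glFiniteIntegralLevel 4 K) (hL3 : isCompact_glFiniteIntegralLevel 3 L)
        (π₀ : CuspidalAutomorphicRepData 4 K hcpt) (P₀ : CuspidalAutomorphicRepData 3 L hL3),
      (∀ᶠ v : HeightOneSpectrum (𝓞 K) in cofinite, ∀ α : Multiset ℂ, π₀.1.HasSatakeParamAt v α →
        ∀ a ∈ α, a ≠ 0) →
      (∀ᶠ w : HeightOneSpectrum (𝓞 L) in cofinite, ∀ β : Multiset ℂ, P₀.1.HasSatakeParamAt w β →
        ∀ b ∈ β, b ≠ 0) →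
      (∀ᶠ v : HeightOneSpectrum (𝓞 K) in cofinite, ∀ α : Multiset ℂ, π₀.1.HasSatakeParamAt v α →
        ((∃ w : HeightOneSpectrum (𝓞 L), w.asIdeal.under (𝓞 K) = v.asIdeal ∧
            w.asIdeal.inertiaDeg (𝓞 K) = 1) →
          ∃ w₁ w₂ : HeightOneSpectrum (𝓞 L), w₁ ≠ w₂ ∧ w₁.asIdeal.under (𝓞 K) = v.asIdeal ∧
            w₂.asIdeal.under (𝓞 K) = v.asIdeal ∧ ∃ β₁ β₂ : Multiset ℂ,
              P₀.1.HasSatakeParamAt w₁ β₁ ∧ P₀.1.HasSatakeParamAt w₂ β₂ ∧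
                (α.powersetCard 2).map Multiset.prod = β₁ + β₂) ∧
        ((¬ ∃ w : HeightOneSpectrum (𝓞 L), w.asIdeal.under (𝓞 K) = v.asIdeal ∧
            w.asIdeal.inertiaDeg (𝓞 K) = 1) →
          ∃ w : HeightOneSpectrum (𝓞 L), w.asIdeal.under (𝓞 K) = v.asIdeal ∧
            ∃ β γ : Multiset ℂ, P₀.1.HasSatakeParamAt w β ∧ γ.map (fun c => c ^ 2) = β ∧
              (α.powersetCard 2).map Multiset.prod = γ + γ.map (fun c => -c))) →
      (∀ᶠ w : HeightOneSpectrum (𝓞 L) in cofinite, ∀ α β : Multiset ℂ,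
        π₀.1.HasSatakeParamAt (w.under (𝓞 K)) α → P₀.1.HasSatakeParamAt w β →
          β.map (fun b => b⁻¹) = β.map (fun b => (α.prod ^ w.asIdeal.inertiaDeg (𝓞 K))⁻¹ * b)) →
      ∃ μ : HeckeCharacter K, ∀ᶠ w : HeightOneSpectrum (𝓞 L) in cofinite, ∀ β : Multiset ℂ,
        P₀.1.HasSatakeParamAt w β →
          β.prod = μ.valueAtUniformizer (w.under (𝓞 K)) ^ w.asIdeal.inertiaDeg (𝓞 K) := by
  intro K L _ _ _ _ _ _ hdeg τ hτ hcpt hL3 π₀ P₀ hZ1 hZ2 hH hI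
  -- (1) the unramified central character `Ω` of `P₀`: `Ω(ϖ_w) = e₃(t_{P₀,w})` a.e.
  obtain ⟨Ω, hΩ⟩ := exists_heckeCharacter_prod_satake' P₀
  -- (2) its Galois conjugate `Ω ∘ τ`
  obtain ⟨Ω', hΩ'⟩ := HeckeCharacter.exists_galConj (F := K) Ω τ
  -- finite fibres of `w ↦ w ∩ 𝓞 K`
  have hU : Tendsto (fun w : HeightOneSpectrum (𝓞 L) => w.under (𝓞 K)) cofinite cofinite :=
    tendsto_under_cofinite (𝓞 K)
  have hπ : ∀ᶠ v : HeightOneSpectrum (𝓞 K) in cofinite, π₀.1.IsUnramifiedAt v :=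
    π₀.1.hasSatakeParamAt_cofinite_holds
  -- (3) KEY: `Ω(ϖ_{τ w}) = Ω(ϖ_w)` for almost all `w`
  have hkey : ∀ᶠ w : HeightOneSpectrum (𝓞 L) in cofinite,
      Ω.valueAtUniformizer (τ • w) = Ω.valueAtUniformizer w := by
    filter_upwards [ccd_eventually_forall_under_eq_under K hΩ,
      ccd_eventually_forall_under_eq_under K hZ2, ccd_eventually_forall_under_eq_under K hI,
      hU.eventually hH, hU.eventually hπ, hU.eventually hZ1] with w h1 h2 h3 h4 h5 h6
    by_cases hfix : τ • w = w
    · rw [hfix]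
    -- `w` is moved by `τ`: `f(w|v) = 1`, `v = w ∩ 𝓞 K` splits into `{w, τ w}`
    have hf1 : w.asIdeal.inertiaDeg (𝓞 K) = 1 :=
      HeightOneSpectrum.inertiaDeg_eq_one_of_smul_ne hdeg hfix
    obtain ⟨α, hα⟩ := h5
    have hα4 : Multiset.card α = 4 := hα.card_eq
    have hω : α.prod ≠ 0 := Multiset.prod_ne_zero fun h0 => h6 α hα 0 h0 rfl
    -- local facts at every place `u` of `L` above `v`
    have LF : ∀ u : HeightOneSpectrum (𝓞 L), u.under (𝓞 K) = w.under (𝓞 K) →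
        ∀ β : Multiset ℂ, P₀.1.HasSatakeParamAt u β →
          β.prod ^ 2 = α.prod ^ 3 ∧ β.prod ≠ 0 ∧ Ω.valueAtUniformizer u = β.prod := by
      intro u hu β hβ
      have hfu : u.asIdeal.inertiaDeg (𝓞 K) = 1 := by
        rw [inertiaDeg_eq_inertiaDegIn_under (F := K) u, hu,
          ← inertiaDeg_eq_inertiaDegIn_under (F := K) w, hf1]
      have hb : β.prod ≠ 0 := Multiset.prod_ne_zero fun h0 => h2 u hu β hβ 0 h0 rfl
      have hα' : π₀.1.HasSatakeParamAt (u.under (𝓞 K)) α := by rw [hu]; exact hα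
      have hIu := h3 u hu α β hα' hβ
      rw [hfu] at hIu
      exact ⟨ccd_prod_sq_eq_of_map_inv_eq hβ.card_eq hω hb hIu, hb, h1 u hu β hβ⟩
    -- the matching hypothesis at the split place `v`
    obtain ⟨w₁, w₂, hne, hw₁, hw₂, β₁, β₂, hβ₁, hβ₂, hsum⟩ := (h4 α hα).1 ⟨w, rfl, hf1⟩
    have hw₁' : w₁.under (𝓞 K) = w.under (𝓞 K) := HeightOneSpectrum.ext hw₁
    have hw₂' : w₂.under (𝓞 K) = w.under (𝓞 K) := HeightOneSpectrum.ext hw₂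
    obtain ⟨hsq₁, hb₁, hΩ₁⟩ := LF w₁ hw₁' β₁ hβ₁
    obtain ⟨-, -, hΩ₂⟩ := LF w₂ hw₂' β₂ hβ₂
    have hprod : β₁.prod * β₂.prod = α.prod ^ 3 := by
      rw [← Multiset.prod_add, ← hsum]
      exact prod_wedgeTwoParams_of_card_eq_four hα4
    have h12 : β₁.prod = β₂.prod := by
      have h' : β₁.prod * β₁.prod = β₁.prod * β₂.prod := by rw [← sq, hsq₁, hprod]
      exact mul_left_cancel₀ hb₁ h'
    have hΩ12 : Ω.valueAtUniformizer w₁ = Ω.valueAtUniformizer w₂ := by rw [hΩ₁, hΩ₂, h12]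
    -- `{w₁, w₂} = {w, τ w}`
    rcases HeightOneSpectrum.eq_or_eq_smul_of_under_eq hdeg hτ hw₁' with rfl | rfl <;>
      rcases HeightOneSpectrum.eq_or_eq_smul_of_under_eq hdeg hτ hw₂' with rfl | rfl
    · exact absurd rfl hne
    · exact hΩ12.symm
    · exact hΩ12
    · exact absurd rfl hne
  -- (4) `Ω ∘ τ = Ω` by Hecke rigidity, so `Ω` is `Gal(L/K)`-invariant
  have hT : Tendsto (fun w : HeightOneSpectrum (𝓞 L) => τ • w) cofinite cofinite :=
    (MulAction.injective τ).tendsto_cofinite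
  have hunr : ∀ᶠ w : HeightOneSpectrum (𝓞 L) in cofinite, Ω.IsUnramifiedAt (τ • w) :=
    hT.eventually (HeckeCharacter.isUnramifiedAt_cofinite_holds Ω)
  have hΩ'eq : Ω' = Ω := by
    refine HeckeCharacter.ext_of_eventually_valueAtUniformizer_eq ?_
    filter_upwards [hkey, hunr] with w hw hu
    rw [HeckeCharacter.valueAtUniformizer_galConj hΩ' hu, hw]
  have hinv : ∀ (σ : L ≃ₐ[K] L) (y : Literature.NumberTheory.GaloisRepresentations.ideleGroup L),
      Ω (σ • y) = Ω y := by
    intro σ y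
    rcases AlgEquiv.eq_one_or_eq_of_finrank_eq_two hdeg hτ σ with rfl | rfl
    · rw [one_smul]
    · rw [← hΩ' y, hΩ'eq]
  -- (5) `GL(1)` descent and the values of a base change at uniformizers
  obtain ⟨μ, hμ⟩ := HeckeCharacter.exists_baseChange_eq_of_forall_smul_eq
    (by rw [hdeg]; exact Nat.prime_two) Ω hinv
  refine ⟨μ, ?_⟩
  filter_upwards [hΩ, HeckeCharacter.eventually_valueAtUniformizer_baseChange (E := L) μ]
    with w hw hbc
  intro β hβ
  rw [← hw β hβ, ← hμ, hbc]

end Summit.Langlands.Langlands.Theorems.InducedSquareAscentKleinCube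

end
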